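import Summits.RiemannHypothesis.RiemannHypothesis.Theorems.TiltedLandingLaw421R3TouchedDissipation
import Summits.RiemannHypothesis.RiemannHypothesis.Theorems.TiltedLandingLaw421R3ColumnImmunity

/-!
# T⁗ — the FRAME-WEIGHTED log-profile dissipation SOCKET `TouchedDissipationLawWQ cF L κ₀` and its instance `TouchedDissipationLawTQ c L κ₀ θ`
(lens-2 g7; TYPED per (CA680)(D2) after CUT 34; memo `lens2/TQ-FRAMEWISE-MEMO-v1.md` ad1b401b, decldiff `lens2/GLUE-V5-DECLDIFF-v1.md` f8dc3f57; a LAW, unproved)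
ONE tree import (C′ module `…R3TouchedDissipation`, #1178).  Self-contained: the log weight `logWeight` of the dead T‴ draft (`lens2/TouchedDissipationL-v1.lean`
64d6c277, never landed) is re-homed here (§1).  PARAMETERS: `c` (dissipation constant), `L` (log slope), `κ₀` (field floor) — binders; `θ` (weight slope) a
binder of the general instance, with the value of record `thetaW = 2` a binder-free def (§1, justified there); NOTHING ELSE BAKED.
STATEMENT.  Same population as C′/T‴ (legal frame; CHARGED APPROACH level `j`; lowest band state `v` touched by a strictly taller zero `z` of `f⁽ʲ⁾`; the
pair atomic; `κ₀ ≤ Im v·κ_v`); with `e := Im v² + Im z²`, `y(e) := 1 + L·log(2Hs²/e)`:   `cF(F)·s² ≤ η²·y(e)²·(e − childEnergy Ū)`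
— T‴'s inequality VERBATIM with the global constant `c` replaced by a FRAME FUNCTIONAL `cF : Budget` (a function of the datum `(η,f,x₀,s,hmax,R,Hs,B)`
only, like every budget of the books).  [Erratum to the decldiff's one-liner, which put `y²` on the left: the benches' merit is `M_row(L) = X″·y²`, so `y²`
multiplies `ΔE`, as in T‴ and in the glue's paying inequality.]  T⁗ = the instance `cF := c / w_F`, `w_F := max(1, θ·(B+1)·(s/Hs)²)` (`frameWeightQ`):
big-`B` frames (one-sided fences, towers: B ≈ 60–110·(Hs/s)²) get the SMALL constant; balanced frames (`w_F = 1`) must carry `c` itself.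
BENCH OF RECORD (crit-1 CUT 34, (CA680), floats): decision number min over LEGAL ∧ CHARGED rows of `M_row(L)·w_F/need(.66, L)` = ×4.2 (row «W2F», L = 0)
among balanced frames, ≥ ×30 among one-sided frames; my predicted killer «W2F-tall» was neither legal nor charged; next adversary named: «W2F-sparse» (l.8232).
KILL: a legal charged atomic approach β-row with `X″·y_L(u)²·w_F < c` at the instance under test.
Nothing here bears on the truth of RH; RH is not proved; T⁗ is a typed LAW (OPEN), it survived ONE cut as a candidate; T″/T‴ dead; C′ typed not proved;
★A / 33346 / 33347 OPEN; checked ≠ landed ≠ proved. -/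

namespace RhW08.TouchedDissipationW

open Complex
open scoped ComplexConjugate
open RhW08.Round1 RhW08.StSwap RhW08.Round2 RhW08.QuadW
open RhW08.SealSwap (PBot)
open RhW08.SealSwapQ RhW08.RateSplit RhW08.BurgersRate RhW08.BurgersRateG3 RhW08.TouchedDissipation
open RhIdea6.G17.W07C7 RhIdea6.G17.W07C7.Rev6 RhIdea6.G18.W07C8.Law421BirthS RhIdea6.G19.W07C11.Seam
open RhIdea6.G20.W07C12.Frac RhIdea6.G20.W07C12.StColP RhW07.C12.FieldSplit RhIdea6.G21.W07C13.TentMax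
open RhW07.C14.TwoSided RhW07.C14.Classes RhW07.C14.Lineage RhW07.C14.Booking

/-! ## §1 Weights -/

/-- §1 the LOG-PROFILE WEIGHT `y(E) = 1 + L·log(2Hs²/E)` of an energy `E` in a strip of height `Hs` (`= 1` at `E = 2Hs²`; Lean junk: `E = 0 ⇒ y = 1`). -/
noncomputable def logWeight (L Hs E : ℝ) : ℝ := 1 + L * Real.log (2 * Hs ^ 2 / E)

/-- §1 the FRAME WEIGHT `w_F := max(1, θ·(B+1)·(s/Hs)²)` — a `Budget` (function of the frame datum only); `≥ 1`; reads `1` whenever `θ·(B+1) ≤ (Hs/s)²`. -/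
noncomputable def frameWeightQ (θ : ℝ) : Budget := fun _η _f _x₀ s _hmax _R Hs B => max 1 (θ * ((B : ℝ) + 1) * (s / Hs) ^ 2)

/-- §1 the WEIGHTED CONSTANT `c_F := c / w_F`. -/
noncomputable def weightedConstQ (c θ : ℝ) : Budget := fun η f x₀ s hmax R Hs B => c / frameWeightQ θ η f x₀ s hmax R Hs B

/-- §1 the weight slope OF RECORD `θ_W := 2` (binder-free).  WHY THIS VALUE, and why it is not a hand-picked truth threshold (checklist 4c(iv)): the law
`TouchedDissipationLawTQ c L κ₀ θ` is WEAKER for LARGER `θ` (`lawTQ_mono_theta`), so `θ` is capped only by what the BOOKS can pay: FIT_W's B-bracket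
(`approachBudgetHalfQ` carries `(3/2)·(B+1)` of capital per frame, `approachBudgetHalf_apply`) reads `φ₀·θ ≤ 3/2` with `φ₀ = (1+2L+2L²)/(2c)`, i.e.
`θ ≤ 3/(2φ₀) ∈ [2, 2.5]` on the purse factors of record `φ₀ ∈ [0.6, 0.75]`; `2` is the largest value payable across that whole range.  Any other `θ` is
another INSTANCE of the socket, not an edit of this file. -/
def thetaW : ℝ := 2

/-! ## §2 The socket and the law (parameters only; nothing instantiated numerically except `thetaW`) -/

/-- (SOCKET W — FRAME-WEIGHTED LOG-PROFILE DISSIPATION ON TOUCHED APPROACH LEVELS; typed, OPEN) for a frame functional `cF`: on a legal frame, at a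
CHARGED APPROACH level `j` whose lowest band state `v` is touched by a strictly taller zero `z` of `f⁽ʲ⁾` (`Touches`), the pair atomic (`AtomicPair`),
the state field above the floor (`κ₀ ≤ Im v·κ_v`): `cF(F)·s² ≤ η²·(1 + L·log(2Hs²/(Im v² + Im z²)))²·((Im v² + Im z²) − childEnergy(Ū))`. -/
def TouchedDissipationLawWQ (cF : Budget) (L κ₀ : ℝ) : Prop :=
  ∀ (η : ℝ) (f : ℂ → ℂ) (x₀ s hmax R Hs : ℝ) (B : ℕ), EngineHyps5 2 η f x₀ s hmax R Hs B →
    ∀ (j : ℕ) (v z : ℂ), Charged (PTrkSQ PBot) StTrkDQ ReadyR2 η f x₀ s hmax R Hs B j → ApproachLevelQ η f x₀ s hmax R Hs B j →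
      IsLowest StTrkDQ η f x₀ s hmax R Hs B j v → Touches f j v z → AtomicPair f j v z →
      κ₀ ≤ v.im * stateKappa f j v →
      cF η f x₀ s hmax R Hs B * s ^ 2
        ≤ η ^ 2 * logWeight L Hs (v.im ^ 2 + z.im ^ 2) ^ 2 * ((v.im ^ 2 + z.im ^ 2) - childEnergy f j (pairUnion v z))

/-- (LAW T⁗(c, L, κ₀, θ) — typed, OPEN) the socket at the weighted constant `c / max(1, θ·(B+1)·(s/Hs)²)`. -/
def TouchedDissipationLawTQ (c L κ₀ θ : ℝ) : Prop := TouchedDissipationLawWQ (weightedConstQ c θ) L κ₀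

/-- (LAW T⁗ OF RECORD — `θ = thetaW = 2`; `c, L, κ₀` parameters) -/
def TouchedDissipationLawTWQ (c L κ₀ : ℝ) : Prop := TouchedDissipationLawTQ c L κ₀ thetaW

/-! ## §3 Bookkeeping (K) -/

/-- (K) `y(2Hs²) = 1` (also for `Hs = 0`). -/
theorem logWeight_top (L Hs : ℝ) : logWeight L Hs (2 * Hs ^ 2) = 1 := by
  unfold logWeight
  by_cases h : 2 * Hs ^ 2 = 0
  · rw [h]; simp
  · rw [div_self h, Real.log_one]; ring

/-- (K) `1 ≤ y(E)` for `0 ≤ L`, `0 < E ≤ 2Hs²`. -/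
theorem one_le_logWeight {L Hs E : ℝ} (hL : 0 ≤ L) (hE : 0 < E) (hEA : E ≤ 2 * Hs ^ 2) : 1 ≤ logWeight L Hs E := by
  unfold logWeight
  have hlog : 0 ≤ Real.log (2 * Hs ^ 2 / E) := Real.log_nonneg ((one_le_div hE).2 hEA)
  nlinarith

/-- (K) `1 ≤ w_F`, hence `0 < w_F`. -/
theorem one_le_frameWeightQ (θ η : ℝ) (f : ℂ → ℂ) (x₀ s hmax R Hs : ℝ) (B : ℕ) : 1 ≤ frameWeightQ θ η f x₀ s hmax R Hs B :=
  le_max_left _ _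

theorem frameWeightQ_pos (θ η : ℝ) (f : ℂ → ℂ) (x₀ s hmax R Hs : ℝ) (B : ℕ) : 0 < frameWeightQ θ η f x₀ s hmax R Hs B :=
  one_pos.trans_le (one_le_frameWeightQ θ η f x₀ s hmax R Hs B)

/-- (K) `w_F ≤ 1 + θ·(B+1)·(s/Hs)²` for `0 ≤ θ` (the form FIT_W's two brackets use). -/
theorem frameWeightQ_le {θ : ℝ} (hθ : 0 ≤ θ) (η : ℝ) (f : ℂ → ℂ) (x₀ s hmax R Hs : ℝ) (B : ℕ) :
    frameWeightQ θ η f x₀ s hmax R Hs B ≤ 1 + θ * ((B : ℝ) + 1) * (s / Hs) ^ 2 := by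
  have h0 : 0 ≤ θ * ((B : ℝ) + 1) * (s / Hs) ^ 2 := by positivity
  exact max_le (by linarith) (by linarith)

/-- (K) `w_F` is monotone in `θ`. -/
theorem frameWeightQ_mono {θ θ' : ℝ} (hθ : θ ≤ θ') (η : ℝ) (f : ℂ → ℂ) (x₀ s hmax R Hs : ℝ) (B : ℕ) :
    frameWeightQ θ η f x₀ s hmax R Hs B ≤ frameWeightQ θ' η f x₀ s hmax R Hs B :=
  max_le_max le_rfl (mul_le_mul_of_nonneg_right (mul_le_mul_of_nonneg_right hθ (by positivity)) (sq_nonneg _))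

/-- (K) `0 < c ⇒ 0 < c_F`, and `0 ≤ c ⇒ c_F ≤ c`. -/
theorem weightedConstQ_pos {c : ℝ} (hc : 0 < c) (θ η : ℝ) (f : ℂ → ℂ) (x₀ s hmax R Hs : ℝ) (B : ℕ) :
    0 < weightedConstQ c θ η f x₀ s hmax R Hs B :=
  div_pos hc (frameWeightQ_pos θ η f x₀ s hmax R Hs B)

theorem weightedConstQ_le {c : ℝ} (hc : 0 ≤ c) (θ η : ℝ) (f : ℂ → ℂ) (x₀ s hmax R Hs : ℝ) (B : ℕ) :
    weightedConstQ c θ η f x₀ s hmax R Hs B ≤ c :=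
  div_le_self hc (one_le_frameWeightQ θ η f x₀ s hmax R Hs B)

/-- (K) the socket is DOWNWARD-closed in the frame functional (pointwise on legal frames) and UPWARD-closed in the floor. -/
theorem lawWQ_mono {cF cF' : Budget} {L κ₀ κ₀' : ℝ}
    (hc : ∀ (η : ℝ) (f : ℂ → ℂ) (x₀ s hmax R Hs : ℝ) (B : ℕ), EngineHyps5 2 η f x₀ s hmax R Hs B →
      cF' η f x₀ s hmax R Hs B ≤ cF η f x₀ s hmax R Hs B)
    (hκ : κ₀ ≤ κ₀') (h : TouchedDissipationLawWQ cF L κ₀) : TouchedDissipationLawWQ cF' L κ₀' :=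
  fun η f x₀ s hmax R Hs B hE j v z hch hA hlow ht ha hfl =>
    (mul_le_mul_of_nonneg_right (hc η f x₀ s hmax R Hs B hE) (sq_nonneg s)).trans
      (h η f x₀ s hmax R Hs B hE j v z hch hA hlow ht ha (hκ.trans hfl))

/-- (K) a FRAME-BLIND constant implies the weighted law: `W(const c) → T⁗(c, θ)` for `0 ≤ c` (T‴, were it true, would give T⁗ — sanity only; T‴ is dead). -/
theorem lawTQ_of_const {c L κ₀ : ℝ} (hc : 0 ≤ c) (θ : ℝ) (h : TouchedDissipationLawWQ (fun _ _ _ _ _ _ _ _ => c) L κ₀) :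
    TouchedDissipationLawTQ c L κ₀ θ :=
  lawWQ_mono (fun η f x₀ s hmax R Hs B _ => weightedConstQ_le hc θ η f x₀ s hmax R Hs B) le_rfl h

/-- (K) T⁗ is DOWNWARD-closed in `c`, UPWARD-closed in `κ₀` and in `θ` (larger weight slope = weaker law), for `0 ≤ c'`. -/
theorem lawTQ_mono_theta {c c' L κ₀ κ₀' θ θ' : ℝ} (hc' : 0 ≤ c') (hcc : c' ≤ c) (hκ : κ₀ ≤ κ₀') (hθ : θ ≤ θ')
    (h : TouchedDissipationLawTQ c L κ₀ θ) : TouchedDissipationLawTQ c' L κ₀' θ' := by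
  refine lawWQ_mono (fun η f x₀ s hmax R Hs B _ => ?_) hκ h
  have hw := frameWeightQ_pos θ η f x₀ s hmax R Hs B
  calc weightedConstQ c' θ' η f x₀ s hmax R Hs B ≤ c' / frameWeightQ θ η f x₀ s hmax R Hs B :=
        div_le_div_of_nonneg_left hc' hw (frameWeightQ_mono hθ η f x₀ s hmax R Hs B)
    _ ≤ weightedConstQ c θ η f x₀ s hmax R Hs B := div_le_div_of_nonneg_right hcc hw.le

/-- (K) on a row of the socket with `0 < cF(F)` the energy drop is NON-NEGATIVE (the weight is squared). -/
theorem drop_nonneg_of_lawWQ {cF : Budget} {L κ₀ : ℝ} (h : TouchedDissipationLawWQ cF L κ₀)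
    {η : ℝ} {f : ℂ → ℂ} {x₀ s hmax R Hs : ℝ} {B : ℕ} (hE : EngineHyps5 2 η f x₀ s hmax R Hs B) (hcF : 0 < cF η f x₀ s hmax R Hs B)
    {j : ℕ} {v z : ℂ} (hch : Charged (PTrkSQ PBot) StTrkDQ ReadyR2 η f x₀ s hmax R Hs B j) (hA : ApproachLevelQ η f x₀ s hmax R Hs B j)
    (hlow : IsLowest StTrkDQ η f x₀ s hmax R Hs B j v) (ht : Touches f j v z) (ha : AtomicPair f j v z) (hfl : κ₀ ≤ v.im * stateKappa f j v) :
    0 ≤ (v.im ^ 2 + z.im ^ 2) - childEnergy f j (pairUnion v z) := by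
  have hs : 0 < s := hE.2.2.2.1
  have hrow := h η f x₀ s hmax R Hs B hE j v z hch hA hlow ht ha hfl
  by_contra hneg
  push Not at hneg
  have h0 : η ^ 2 * logWeight L Hs (v.im ^ 2 + z.im ^ 2) ^ 2 * ((v.im ^ 2 + z.im ^ 2) - childEnergy f j (pairUnion v z)) ≤ 0 :=
    mul_nonpos_of_nonneg_of_nonpos (by positivity) hneg.le
  nlinarith [mul_pos hcF (pow_pos hs 2)]

/-- (K) the weighted purse identity FIT_W reads: `1/c_F = w_F/c`. -/
theorem inv_weightedConstQ (c θ η : ℝ) (f : ℂ → ℂ) (x₀ s hmax R Hs : ℝ) (B : ℕ) :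
    1 / weightedConstQ c θ η f x₀ s hmax R Hs B = frameWeightQ θ η f x₀ s hmax R Hs B / c := by
  unfold weightedConstQ
  rw [one_div, inv_div]

end RhW08.TouchedDissipationW


/-!
# Glue v5 — ★A from the T⁗ socket + Γ3′ + Γ4 + FIT_W, with the REPAIRED log-profile potential Φ̃_L (lens-2 g7; (CA680)(D2); HELD; 0 sorry)
= glue v4 `lens2/TouchedGlue-sketch-v4.lean` dbae8648 with the DECLDIFF of `lens2/GLUE-V5-DECLDIFF-v1.md` f8dc3f57: (i) the global constant `c` becomes the
frame functional `cF : Budget` of the socket `TouchedDissipationLawWQ cF L κ₀` (module `…R3TouchedDissipationW`); T⁗ = the instance `cF = weightedConstQ c θ`;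
(ii) crit-1's PRICE-HOLE repair (census l.8164 (iii′): plain Φ_L-rises booked at pre-β levels incl. touch-ON, worst 1.70·purse): the potential is
`Φ̃_k := betaPurse` for `k < firstBetaQ` (the frame's first β-level) and `Φ_L(E_k)` from it on (`betaPotentialWQ`), so the touch-ON rise is a DROP of Φ̃ and
the rise meter `touchRiseWQ` (re-based on Φ̃) books nothing before the first β-level; (iii) FIT_W per frame: `betaPurseWQ cF L + aT + aRest ≤ budget`, and
for the T⁗ instance the TWO-BRACKET form `φ₀·(Hs/s)² + φ₀·θ·(B+1) + aT + aRest ≤ approachBudgetHalfQ riseSupQ consSupQ` (`approachC_of_TQ_brackets`;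
`φ₀ = (1+2L+2L²)/(2c)`).  Token-identical from v4: §G0 (Φ_L algebra), the level objects, Γ2′ `PersistenceOrRetouchQ`, every §G3 lemma on heights/energies/
`phiLE`, §G5 `classLawQ_mono`/`approachAllowanceQ_of_beta_rest`.  Imports: module W (one tree import itself) + `…R3ColumnImmunity` (strip heredity).
THE GLUE (PROVED; the gaps are the NAMED TYPED HYPOTHESES): `approachC_of_TW : (∀ legal F, 0 < cF F) → 0 ≤ L → W(cF, L, κ₀) → Γ3′ TouchRiseLawWQ cF L κ₀ aT →
Γ4 ClassLawQ (Approach ∖ β) aRest → FIT_W → ApproachAllowanceQ (approachBudgetHalfQ aR aC)`; canonical instance = the registry's `stub_approachC` type.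
★A DECOMPOSITION OF RECORD rev 7: C′ + T⁗(c, L, κ₀, θ) + Γ2′ + Γ3′(Σ RTB ≤ aT) + Γ4 + FIT_W, all constants PARAMETERS; numbers only from certified rows
(decision number of record ×4.2, CUT 34, floats).  Nothing here bears on the truth of RH; RH is not proved; T⁗/Γ3′/Γ4 are LAWS (typed, unproved), C′ typed
not proved; ★A / 33346 / 33347 OPEN; checked ≠ landed ≠ proved. -/

namespace RhW08.TouchedGlueW

open Complex
open scoped ComplexConjugate
open RhW08.Round1 RhW08.StSwap RhW08.Round2 RhW08.QuadW
open RhW08.SealSwap (PBot)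
open RhW08.SealSwapQ RhW08.RateSplit RhW08.BurgersRate RhW08.BurgersRateG3 RhW08.TouchedDissipation RhW08.TouchedDissipationW
open RhIdea6.G17.W07C7 RhIdea6.G17.W07C7.Rev6 RhIdea6.G18.W07C8.Law421BirthS RhIdea6.G19.W07C11.Seam
open RhIdea6.G20.W07C12.Frac RhIdea6.G20.W07C12.StColP RhW07.C12.FieldSplit RhIdea6.G21.W07C13.TentMax
open RhW07.C14.TwoSided RhW07.C14.Classes RhW07.C14.Lineage RhW07.C14.Booking

/-! ## §G0 The Φ_L algebra (pure real functions; PROVED; v4 verbatim) -/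

/-- §G0 `g_L(E) := E·(y² + 2Ly + 2L²)`, `y = logWeight L Hs E`; `Φ_L = (η²/(c s²))·g_L`. -/
noncomputable def gL (L Hs E : ℝ) : ℝ := E * (logWeight L Hs E ^ 2 + 2 * L * logWeight L Hs E + 2 * L ^ 2)

theorem gL_zero (L Hs : ℝ) : gL L Hs 0 = 0 := by simp [gL]

theorem gL_top (L Hs : ℝ) : gL L Hs (2 * Hs ^ 2) = 2 * Hs ^ 2 * (1 + 2 * L + 2 * L ^ 2) := by
  rw [gL, logWeight_top]; ring

theorem gL_nonneg (L Hs : ℝ) {E : ℝ} (hE : 0 ≤ E) : 0 ≤ gL L Hs E :=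
  mul_nonneg hE (by nlinarith [sq_nonneg (logWeight L Hs E + L), sq_nonneg L])

/-- (K) the algebraic core of the tangent inequality: `t ≥ 1 + δ + δ²/2` (`t = e^δ`, `δ ≥ 0`), `y ≥ 1`, `L, E′ ≥ 0`. -/
theorem tangent_core {L y δ t E' : ℝ} (hL : 0 ≤ L) (hy : 1 ≤ y) (ht : 1 + δ + δ ^ 2 / 2 ≤ t) (hE' : 0 ≤ E') :
    y ^ 2 * (E' * t - E') ≤ E' * t * (y ^ 2 + 2 * L * y + 2 * L ^ 2) - E' * ((y + L * δ) ^ 2 + 2 * L * (y + L * δ) + 2 * L ^ 2) := by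
  nlinarith [mul_nonneg (mul_nonneg (mul_nonneg hE' hL) (by linarith : 0 ≤ y + L)) (by linarith : 0 ≤ t - 1 - δ - δ ^ 2 / 2),
    mul_nonneg (mul_nonneg (mul_nonneg hE' hL) (sq_nonneg δ)) (by linarith : (0 : ℝ) ≤ y)]

/-- ★ (K) TANGENT INEQUALITY = concavity of `g_L` on `(0, 2Hs²]`: `0 ≤ L`, `0 < Hs`, `0 ≤ E′ ≤ E ≤ 2Hs²` ⇒ `y(E)²·(E − E′) ≤ g_L(E) − g_L(E′)`. -/
theorem gL_tangent {L Hs E E' : ℝ} (hL : 0 ≤ L) (hHs : 0 < Hs) (hE'0 : 0 ≤ E') (hE'E : E' ≤ E) (hEA : E ≤ 2 * Hs ^ 2) :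
    logWeight L Hs E ^ 2 * (E - E') ≤ gL L Hs E - gL L Hs E' := by
  have hA : 0 < 2 * Hs ^ 2 := by positivity
  rcases hE'0.eq_or_lt with h0 | hpos
  · rw [← h0, gL_zero, sub_zero, sub_zero, gL]
    have hE0 : 0 ≤ E := h0.le.trans hE'E
    rcases hE0.eq_or_lt with hz | hEpos
    · rw [← hz]; simp
    · have hy := one_le_logWeight hL hEpos hEA
      nlinarith [mul_nonneg (mul_nonneg hL hEpos.le) (by linarith : 0 ≤ logWeight L Hs E + L)]
  · have hEpos : 0 < E := hpos.trans_le hE'E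
    have hy1 : 1 ≤ logWeight L Hs E := one_le_logWeight hL hEpos hEA
    set y := logWeight L Hs E with hy_def
    set δ := Real.log E - Real.log E' with hδ_def
    have hδ0 : 0 ≤ δ := sub_nonneg.2 (Real.log_le_log hpos hE'E)
    set t := Real.exp δ with ht_def
    have hy' : logWeight L Hs E' = y + L * δ := by
      rw [hy_def, hδ_def, logWeight, logWeight, Real.log_div hA.ne' hpos.ne', Real.log_div hA.ne' hEpos.ne']; ring
    have ht : E = E' * t := by
      rw [ht_def, hδ_def, Real.exp_sub, Real.exp_log hEpos, Real.exp_log hpos]; field_simp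
    have key := tangent_core hL hy1 (Real.quadratic_le_exp_of_nonneg hδ0) hpos.le (L := L)
    rw [gL, gL, hy', ← hy_def, ht]
    exact key

/-! ## §G1 Level objects -/

/-- §G1 the TOUCHER HEIGHT of level `j`: `sSup` of `Im z` over the touchers `z` of the lowest band states (`sSup ∅ = 0`). -/
noncomputable def touchH : LevelMeter := fun η f x₀ s hmax R Hs B j =>
  sSup ((fun z : ℂ => z.im) '' {z : ℂ | ∃ v : ℂ, IsLowest StTrkDQ η f x₀ s hmax R Hs B j v ∧ Touches f j v z})

/-- §G1 the PAIR ENERGY meter `E j := lowH j² + touchH j²`. -/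
noncomputable def touchEnergyQ : LevelMeter := fun η f x₀ s hmax R Hs B j =>
  lowH StTrkDQ η f x₀ s hmax R Hs B j ^ 2 + touchH η f x₀ s hmax R Hs B j ^ 2

/-- §G1 the PAID β CLASS: approach levels whose lowest band state is touched by a strictly taller zero, the pair atomic, the field above the floor. -/
def BetaLevelQ (κ₀ : ℝ) : LevelClass := fun η f x₀ s hmax R Hs B j =>
  ApproachLevelQ η f x₀ s hmax R Hs B j ∧
    ∃ v z : ℂ, IsLowest StTrkDQ η f x₀ s hmax R Hs B j v ∧ Touches f j v z ∧ AtomicPair f j v z ∧ κ₀ ≤ v.im * stateKappa f j v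

/-- §G1 a β-WITNESS of level `k`: a pair `p = (v, z)` carrying the socket's six level binders. -/
def BetaWitnessQ (κ₀ η : ℝ) (f : ℂ → ℂ) (x₀ s hmax R Hs : ℝ) (B k : ℕ) (p : ℂ × ℂ) : Prop :=
  Charged (PTrkSQ PBot) StTrkDQ ReadyR2 η f x₀ s hmax R Hs B k ∧ ApproachLevelQ η f x₀ s hmax R Hs B k ∧
    IsLowest StTrkDQ η f x₀ s hmax R Hs B k p.1 ∧ Touches f k p.1 p.2 ∧ AtomicPair f k p.1 p.2 ∧ κ₀ ≤ p.1.im * stateKappa f k p.1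

/-- §G1 `Φ_L(E) = (η²/(c s²))·g_L(E)` at a (frame) constant `c`. -/
noncomputable def phiLE (c L η s Hs E : ℝ) : ℝ := η ^ 2 / (c * s ^ 2) * gL L Hs E

open Classical in
/-- §G1 the FIRST β-LEVEL of a frame: `sInf {k | BetaLevelQ κ₀ k}` (junk `0` if there is none — then no β-level is ever booked). -/
noncomputable def firstBetaQ (κ₀ η : ℝ) (f : ℂ → ℂ) (x₀ s hmax R Hs : ℝ) (B : ℕ) : ℕ :=
  sInf {k : ℕ | BetaLevelQ κ₀ η f x₀ s hmax R Hs B k}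

/-- §G1 the β PURSE at the frame constant: `(1 + 2L + 2L²)·(Hs/s)²/(2·cF(F))` (`= Φ_L(2Hs²)` at `η = 1/2`). -/
noncomputable def betaPurseWQ (cF : Budget) (L : ℝ) : Budget := fun η f x₀ s hmax R Hs B =>
  (1 + 2 * L + 2 * L ^ 2) * (Hs / s) ^ 2 / (2 * cF η f x₀ s hmax R Hs B)

/-- §G1 the REPAIRED β POTENTIAL `Φ̃_k`: the full purse before the first β-level, `Φ_L(E k)` (at the frame constant `cF(F)`) from it on. -/
noncomputable def betaPotentialWQ (cF : Budget) (L κ₀ : ℝ) : LevelMeter := fun η f x₀ s hmax R Hs B k =>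
  if k < firstBetaQ κ₀ η f x₀ s hmax R Hs B then betaPurseWQ cF L η f x₀ s hmax R Hs B
  else phiLE (cF η f x₀ s hmax R Hs B) L η s Hs (touchEnergyQ η f x₀ s hmax R Hs B k)

open Classical in
/-- §G1 the RETOUCH RISE `RTB_k := [Φ_L(E (k+1)) − Φ_L(childEnergy Ū_k)]⁺` at a level with a β-witness (`Ū_k` of a CHOSEN witness; every law binder is
`∀ v z`, so the choice is immaterial — Γ3′ is priced at the WORST toucher), else `0`. -/
noncomputable def retouchRiseWQ (cF : Budget) (L κ₀ : ℝ) : LevelMeter := fun η f x₀ s hmax R Hs B k =>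
  if h : ∃ p : ℂ × ℂ, BetaWitnessQ κ₀ η f x₀ s hmax R Hs B k p then
    max (phiLE (cF η f x₀ s hmax R Hs B) L η s Hs (touchEnergyQ η f x₀ s hmax R Hs B (k + 1))
      - phiLE (cF η f x₀ s hmax R Hs B) L η s Hs (childEnergy f k (pairUnion (Classical.choose h).1 (Classical.choose h).2))) 0
  else 0

/-- §G1 the RISE METER on Φ̃: `max([Φ̃(k+1) − Φ̃(k)]⁺, RTB_k) + 4·[−drop_k]⁺/s` (nothing is booked before the first β-level: Φ̃ is constant there). -/
noncomputable def touchRiseWQ (cF : Budget) (L κ₀ : ℝ) : LevelMeter := fun η f x₀ s hmax R Hs B k =>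
  max (max (betaPotentialWQ cF L κ₀ η f x₀ s hmax R Hs B (k + 1) - betaPotentialWQ cF L κ₀ η f x₀ s hmax R Hs B k) 0)
      (retouchRiseWQ cF L κ₀ η f x₀ s hmax R Hs B k)
    + 4 * max (-dropQ η f x₀ s hmax R Hs B k) 0 / s

/-! ## §G2 The named gaps (typed, OPEN — hypotheses of the glue, not sorries) -/

/-- (Γ2′ — CENSUS DICHOTOMY, NOT a binder of the glue) at a β-level either the next pair energy is at most the children's energy in `Ū` (persistence:
`RTB_k = 0`) or the next lowest state has a toucher OUTSIDE `Ū` (a RETOUCH, priced by `RTB_k`; price note `lens2/RETOUCH-PRICE-NOTE-v1.md`). -/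
def PersistenceOrRetouchQ (κ₀ : ℝ) : Prop :=
  ∀ (η : ℝ) (f : ℂ → ℂ) (x₀ s hmax R Hs : ℝ) (B : ℕ), EngineHyps5 2 η f x₀ s hmax R Hs B →
    ∀ (j : ℕ) (v z : ℂ), Charged (PTrkSQ PBot) StTrkDQ ReadyR2 η f x₀ s hmax R Hs B j → ApproachLevelQ η f x₀ s hmax R Hs B j →
      IsLowest StTrkDQ η f x₀ s hmax R Hs B j v → Touches f j v z → AtomicPair f j v z → κ₀ ≤ v.im * stateKappa f j v →
      touchEnergyQ η f x₀ s hmax R Hs B (j + 1) ≤ childEnergy f j (pairUnion v z) ∨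
        ∃ v' ρ : ℂ, IsLowest StTrkDQ η f x₀ s hmax R Hs B (j + 1) v' ∧ Touches f (j + 1) v' ρ ∧ ρ ∉ pairUnion v z

/-- (Γ3′, OPEN as to SIZE — LOAD-BEARING) RISE ALLOWANCE in Φ̃ units: before the horizon the booked rises `touchRiseWQ` stay within `aT`. -/
def TouchRiseLawWQ (cF : Budget) (L κ₀ : ℝ) (aT : Budget) : Prop :=
  ∀ (η : ℝ) (f : ℂ → ℂ) (x₀ s hmax R Hs : ℝ) (B : ℕ), EngineHyps5 2 η f x₀ s hmax R Hs B →
    ∀ k : ℕ, Charged (PTrkSQ PBot) StTrkDQ ReadyR2 η f x₀ s hmax R Hs B k →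
      prefixSumQ (touchRiseWQ cF L κ₀) η f x₀ s hmax R Hs B (k + 1) ≤ aT η f x₀ s hmax R Hs B

/-! ## §G3 Bookkeeping of the level objects (K) -/

theorem lowH_le_Hs {η : ℝ} {f : ℂ → ℂ} {x₀ s hmax R Hs : ℝ} {B : ℕ} (hE : EngineHyps5 2 η f x₀ s hmax R Hs B) (k : ℕ) :
    lowH StTrkDQ η f x₀ s hmax R Hs B k ≤ Hs := by
  have hHs : 0 ≤ Hs := hE.2.2.2.2.2.2.2.1
  by_cases hex : ∃ u : ℂ, StTrkDQ η f x₀ s hmax R Hs B k u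
  · obtain ⟨u, hu⟩ := hex
    exact (lowH_le hu).trans (RhW08.Column.abs_im_le_of_level hE hu.1 hu.2.1)
  · have hset : {u : ℂ | StTrkDQ η f x₀ s hmax R Hs B k u} = ∅ := by
      ext u
      simp only [Set.mem_setOf_eq, Set.mem_empty_iff_false, iff_false]
      exact fun hu => hex ⟨u, hu⟩
    show sInf ((fun u : ℂ => |u.im|) '' {u : ℂ | StTrkDQ η f x₀ s hmax R Hs B k u}) ≤ Hs
    rw [hset, Set.image_empty, Real.sInf_empty]
    exact hHs

theorem touchH_nonneg (η : ℝ) (f : ℂ → ℂ) (x₀ s hmax R Hs : ℝ) (B k : ℕ) : 0 ≤ touchH η f x₀ s hmax R Hs B k := by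
  refine Real.sSup_nonneg ?_
  rintro x ⟨z, ⟨v, hlow, ht⟩, rfl⟩
  exact ((hlow.1.2.2.1).trans ht.2.1).le

theorem touchH_le_Hs {η : ℝ} {f : ℂ → ℂ} {x₀ s hmax R Hs : ℝ} {B : ℕ} (hE : EngineHyps5 2 η f x₀ s hmax R Hs B) (k : ℕ) :
    touchH η f x₀ s hmax R Hs B k ≤ Hs := by
  refine Real.sSup_le ?_ hE.2.2.2.2.2.2.2.1
  rintro x ⟨z, ⟨v, hlow, ht⟩, rfl⟩
  exact (le_abs_self _).trans (RhW08.Column.abs_im_le_of_level hE hlow.1.1 ht.1)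

theorem touchEnergyQ_nonneg (η : ℝ) (f : ℂ → ℂ) (x₀ s hmax R Hs : ℝ) (B k : ℕ) : 0 ≤ touchEnergyQ η f x₀ s hmax R Hs B k := by
  unfold touchEnergyQ; positivity

theorem touchEnergyQ_le {η : ℝ} {f : ℂ → ℂ} {x₀ s hmax R Hs : ℝ} {B : ℕ} (hE : EngineHyps5 2 η f x₀ s hmax R Hs B) (k : ℕ) :
    touchEnergyQ η f x₀ s hmax R Hs B k ≤ 2 * Hs ^ 2 := by
  have h1 : lowH StTrkDQ η f x₀ s hmax R Hs B k ^ 2 ≤ Hs ^ 2 := pow_le_pow_left₀ lowH_nonneg' (lowH_le_Hs hE k) 2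
  have h2 : touchH η f x₀ s hmax R Hs B k ^ 2 ≤ Hs ^ 2 :=
    pow_le_pow_left₀ (touchH_nonneg η f x₀ s hmax R Hs B k) (touchH_le_Hs hE k) 2
  unfold touchEnergyQ; linarith

/-- (K) at a level with lowest band state `v` touched by `z`: `Im v² + Im z² ≤ E k`. -/
theorem pair_le_touchEnergyQ {η : ℝ} {f : ℂ → ℂ} {x₀ s hmax R Hs : ℝ} {B k : ℕ} {v z : ℂ} (hE : EngineHyps5 2 η f x₀ s hmax R Hs B)
    (hlow : IsLowest StTrkDQ η f x₀ s hmax R Hs B k v) (ht : Touches f k v z) :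
    v.im ^ 2 + z.im ^ 2 ≤ touchEnergyQ η f x₀ s hmax R Hs B k := by
  have hL : lowH StTrkDQ η f x₀ s hmax R Hs B k = v.im := lowH_eq_of_isLowest hlow
  have hbdd : BddAbove ((fun z : ℂ => z.im) '' {z : ℂ | ∃ v : ℂ, IsLowest StTrkDQ η f x₀ s hmax R Hs B k v ∧ Touches f k v z}) := by
    refine ⟨Hs, ?_⟩
    rintro x ⟨z', ⟨v', hlow', ht'⟩, rfl⟩
    exact (le_abs_self _).trans (RhW08.Column.abs_im_le_of_level hE hlow'.1.1 ht'.1)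
  have hz : z.im ≤ touchH η f x₀ s hmax R Hs B k := le_csSup hbdd ⟨z, ⟨v, hlow, ht⟩, rfl⟩
  have hz2 : z.im ^ 2 ≤ touchH η f x₀ s hmax R Hs B k ^ 2 := pow_le_pow_left₀ ((hlow.1.2.2.1.trans ht.2.1).le) hz 2
  unfold touchEnergyQ; rw [hL]; linarith

/-- (K) a touched lowest pair on a legal frame sits in the strip: `Im v² + Im z² ≤ 2Hs²` and `0 < Hs`. -/
theorem pair_le_twoHsSq {η : ℝ} {f : ℂ → ℂ} {x₀ s hmax R Hs : ℝ} {B k : ℕ} {v z : ℂ} (hE : EngineHyps5 2 η f x₀ s hmax R Hs B)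
    (hlow : IsLowest StTrkDQ η f x₀ s hmax R Hs B k v) (ht : Touches f k v z) :
    v.im ^ 2 + z.im ^ 2 ≤ 2 * Hs ^ 2 ∧ 0 < Hs := by
  have hv : |v.im| ≤ Hs := RhW08.Column.abs_im_le_of_level hE hlow.1.1 hlow.1.2.1
  have hz : |z.im| ≤ Hs := RhW08.Column.abs_im_le_of_level hE hlow.1.1 ht.1
  have hv2 : v.im ^ 2 ≤ Hs ^ 2 := by rw [← sq_abs]; exact pow_le_pow_left₀ (abs_nonneg _) hv 2
  have hz2 : z.im ^ 2 ≤ Hs ^ 2 := by rw [← sq_abs]; exact pow_le_pow_left₀ (abs_nonneg _) hz 2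
  exact ⟨by linarith, hlow.1.2.2.1.trans_le ((le_abs_self _).trans hv)⟩

theorem phiLE_nonneg {c : ℝ} (hc : 0 < c) (L η s Hs : ℝ) {E : ℝ} (hE : 0 ≤ E) : 0 ≤ phiLE c L η s Hs E := by
  unfold phiLE
  exact mul_nonneg (div_nonneg (sq_nonneg η) (mul_nonneg hc.le (sq_nonneg s))) (gL_nonneg L Hs hE)

/-- ★ (K) THE PAYING INEQUALITY of Φ_L: `0 ≤ E′ ≤ E ≤ 2Hs²` ⇒ `(η²/(c s²))·y(E)²·(E − E′) ≤ Φ_L(E) − Φ_L(E′)`. -/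
theorem phiLE_sub_ge {c L η s Hs E E' : ℝ} (hc : 0 < c) (hL : 0 ≤ L) (hHs : 0 < Hs) (hE'0 : 0 ≤ E') (hE'E : E' ≤ E)
    (hEA : E ≤ 2 * Hs ^ 2) : η ^ 2 / (c * s ^ 2) * (logWeight L Hs E ^ 2 * (E - E')) ≤ phiLE c L η s Hs E - phiLE c L η s Hs E' := by
  unfold phiLE; rw [← mul_sub]
  exact mul_le_mul_of_nonneg_left (gL_tangent hL hHs hE'0 hE'E hEA) (div_nonneg (sq_nonneg η) (mul_nonneg hc.le (sq_nonneg s)))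

theorem phiLE_mono {c L η s Hs E E' : ℝ} (hc : 0 < c) (hL : 0 ≤ L) (hHs : 0 < Hs) (hE'0 : 0 ≤ E') (hE'E : E' ≤ E)
    (hEA : E ≤ 2 * Hs ^ 2) : phiLE c L η s Hs E' ≤ phiLE c L η s Hs E := by
  have h := phiLE_sub_ge (η := η) (s := s) hc hL hHs hE'0 hE'E hEA
  have h0 : 0 ≤ η ^ 2 / (c * s ^ 2) * (logWeight L Hs E ^ 2 * (E - E')) :=
    mul_nonneg (div_nonneg (sq_nonneg η) (mul_nonneg hc.le (sq_nonneg s))) (mul_nonneg (sq_nonneg _) (sub_nonneg.2 hE'E))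
  linarith

/-- ★ (K) THE PURSE of Φ_L: `0 ≤ E ≤ 2Hs²`, `0 ≤ Hs`, `0 ≤ η ≤ 1/2` ⇒ `Φ_L(E) ≤ (1 + 2L + 2L²)·(Hs/s)²/(2c)`. -/
theorem phiLE_le_purse {c L η s Hs E : ℝ} (hc : 0 < c) (hL : 0 ≤ L) (hs : 0 < s) (hη0 : 0 ≤ η) (hη1 : 2 * η ≤ 1) (hHs : 0 ≤ Hs)
    (hE0 : 0 ≤ E) (hEA : E ≤ 2 * Hs ^ 2) : phiLE c L η s Hs E ≤ (1 + 2 * L + 2 * L ^ 2) * (Hs / s) ^ 2 / (2 * c) := by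
  have hη2 : η ^ 2 ≤ 1 / 4 := by nlinarith
  have hq : 0 ≤ 1 + 2 * L + 2 * L ^ 2 := by nlinarith
  rcases hHs.eq_or_lt with hz | hHs'
  · have hE : E = 0 := le_antisymm (by rw [← hz] at hEA; simpa using hEA) hE0
    rw [hE, phiLE, gL_zero, mul_zero]
    positivity
  · have htop : gL L Hs E ≤ 2 * Hs ^ 2 * (1 + 2 * L + 2 * L ^ 2) := by
      have h := gL_tangent hL hHs' hE0 hEA le_rfl
      rw [gL_top, logWeight_top] at h
      nlinarith
    have hcoef : 0 ≤ η ^ 2 / (c * s ^ 2) := by positivity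
    calc phiLE c L η s Hs E = η ^ 2 / (c * s ^ 2) * gL L Hs E := rfl
      _ ≤ η ^ 2 / (c * s ^ 2) * (2 * Hs ^ 2 * (1 + 2 * L + 2 * L ^ 2)) := mul_le_mul_of_nonneg_left htop hcoef
      _ = 2 * Hs ^ 2 * (1 + 2 * L + 2 * L ^ 2) / (c * s ^ 2) * η ^ 2 := by ring
      _ ≤ 2 * Hs ^ 2 * (1 + 2 * L + 2 * L ^ 2) / (c * s ^ 2) * (1 / 4) :=
          mul_le_mul_of_nonneg_left hη2 (by positivity)
      _ = (1 + 2 * L + 2 * L ^ 2) * (Hs / s) ^ 2 / (2 * c) := by field_simp; ring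

/-- (K) per-frame reading of the β purse. -/
theorem betaPurseWQ_apply (cF : Budget) (L η : ℝ) (f : ℂ → ℂ) (x₀ s hmax R Hs : ℝ) (B : ℕ) :
    betaPurseWQ cF L η f x₀ s hmax R Hs B = (1 + 2 * L + 2 * L ^ 2) * (Hs / s) ^ 2 / (2 * cF η f x₀ s hmax R Hs B) := rfl

/-- (K) a β-level is not before the first β-level. -/
theorem firstBetaQ_le {κ₀ η : ℝ} {f : ℂ → ℂ} {x₀ s hmax R Hs : ℝ} {B k : ℕ} (hk : BetaLevelQ κ₀ η f x₀ s hmax R Hs B k) :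
    firstBetaQ κ₀ η f x₀ s hmax R Hs B ≤ k :=
  Nat.sInf_le hk

/-- (K) the two cases of Φ̃. -/
theorem betaPotentialWQ_of_le {cF : Budget} {L κ₀ η : ℝ} {f : ℂ → ℂ} {x₀ s hmax R Hs : ℝ} {B k : ℕ}
    (hk : firstBetaQ κ₀ η f x₀ s hmax R Hs B ≤ k) : betaPotentialWQ cF L κ₀ η f x₀ s hmax R Hs B k
      = phiLE (cF η f x₀ s hmax R Hs B) L η s Hs (touchEnergyQ η f x₀ s hmax R Hs B k) := by
  unfold betaPotentialWQ; rw [if_neg (not_lt.2 hk)]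

theorem betaPotentialWQ_of_lt {cF : Budget} {L κ₀ η : ℝ} {f : ℂ → ℂ} {x₀ s hmax R Hs : ℝ} {B k : ℕ}
    (hk : k < firstBetaQ κ₀ η f x₀ s hmax R Hs B) :
    betaPotentialWQ cF L κ₀ η f x₀ s hmax R Hs B k = betaPurseWQ cF L η f x₀ s hmax R Hs B := by
  unfold betaPotentialWQ; rw [if_pos hk]

/-! ## §G4 ★ The β class law from the socket + Γ3′ — PROVED (no persistence hypothesis, no state cap) -/

open Classical in
set_option maxHeartbeats 800000 in
/-- ★★ (K) **W(cF) + RISE ALLOWANCE ⟹ the β CLASS LAW** with allowance `betaPurseWQ cF L + aT`, by the books' socket `classLawQ_of_potential_rises` with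
`Φ = Φ̃` and rise meter `touchRiseWQ`: at a charged β-level `k` (so `firstBetaQ ≤ k` and Φ̃ = Φ_L there and at `k+1`)
`Φ_L(E_k) ≥ Φ_L(e_k) ≥ Φ_L(childEnergy Ū_k) + 1 ≥ Φ_L(E_{k+1}) − RTB_k + 1` (monotonicity; the paying inequality at the pair energy `e_k` read against the
socket row at the frame constant `cF(F) > 0`; the definition of `RTB_k`); off β-levels `Φ̃(k+1) − Φ̃(k) ≤ meter`. -/
theorem betaClassLaw_of_TW {cF : Budget} {L κ₀ : ℝ} {aT : Budget}
    (hcF : ∀ (η : ℝ) (f : ℂ → ℂ) (x₀ s hmax R Hs : ℝ) (B : ℕ), EngineHyps5 2 η f x₀ s hmax R Hs B → 0 < cF η f x₀ s hmax R Hs B)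
    (hL : 0 ≤ L) (hT : TouchedDissipationLawWQ cF L κ₀) (hrise : TouchRiseLawWQ cF L κ₀ aT) :
    ClassLawQ (BetaLevelQ κ₀) (addBudget (betaPurseWQ cF L) aT) := by
  refine classLawQ_of_potential_rises (betaPotentialWQ cF L κ₀) (touchRiseWQ cF L κ₀) ?_
  intro η f x₀ s hmax R Hs B hE
  have hc : 0 < cF η f x₀ s hmax R Hs B := hcF η f x₀ s hmax R Hs B hE
  have hs : 0 < s := hE.2.2.2.1
  have hHs0 : 0 ≤ Hs := hE.2.2.2.2.2.2.2.1
  have hη0 : 0 ≤ η := hE.2.2.2.2.2.2.2.2.2.2.2.2.2.1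
  have hη1 : 2 * η ≤ 1 := hE.2.2.2.2.2.2.2.2.2.2.2.2.2.2.1
  have hpurse0 : 0 ≤ betaPurseWQ cF L η f x₀ s hmax R Hs B := by
    rw [betaPurseWQ_apply]
    exact div_nonneg (mul_nonneg (by nlinarith) (sq_nonneg _)) (by positivity)
  have hΦle : ∀ k : ℕ, firstBetaQ κ₀ η f x₀ s hmax R Hs B ≤ k →
      betaPotentialWQ cF L κ₀ η f x₀ s hmax R Hs B k ≤ betaPurseWQ cF L η f x₀ s hmax R Hs B := fun k hk => by
    rw [betaPotentialWQ_of_le hk, betaPurseWQ_apply]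
    exact phiLE_le_purse hc hL hs hη0 hη1 hHs0 (touchEnergyQ_nonneg η f x₀ s hmax R Hs B k) (touchEnergyQ_le hE k)
  refine ⟨fun k => ?_, ?_, fun k hk => hrise η f x₀ s hmax R Hs B hE k hk, fun k _ => ?_⟩
  · by_cases hk : k < firstBetaQ κ₀ η f x₀ s hmax R Hs B
    · rw [betaPotentialWQ_of_lt hk]; exact hpurse0
    · rw [betaPotentialWQ_of_le (not_lt.1 hk)]
      exact phiLE_nonneg hc L η s Hs (touchEnergyQ_nonneg η f x₀ s hmax R Hs B k)
  · show betaPotentialWQ cF L κ₀ η f x₀ s hmax R Hs B 0 ≤ betaPurseWQ cF L η f x₀ s hmax R Hs B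
    by_cases h0 : 0 < firstBetaQ κ₀ η f x₀ s hmax R Hs B
    · rw [betaPotentialWQ_of_lt h0]
    · exact hΦle 0 (Nat.le_of_not_lt h0)
  · -- the step across level `k`
    have hdrop : -(4 * dropQ η f x₀ s hmax R Hs B k / s) ≤ 4 * max (-dropQ η f x₀ s hmax R Hs B k) 0 / s := by
      rw [← neg_div, ← mul_neg]
      exact div_le_div_of_nonneg_right (mul_le_mul_of_nonneg_left (le_max_left _ _) (by norm_num)) hs.le
    have hm1 : betaPotentialWQ cF L κ₀ η f x₀ s hmax R Hs B (k + 1) - betaPotentialWQ cF L κ₀ η f x₀ s hmax R Hs B k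
        ≤ max (max (betaPotentialWQ cF L κ₀ η f x₀ s hmax R Hs B (k + 1) - betaPotentialWQ cF L κ₀ η f x₀ s hmax R Hs B k) 0)
            (retouchRiseWQ cF L κ₀ η f x₀ s hmax R Hs B k) := (le_max_left _ _).trans (le_max_left _ _)
    have hR' : retouchRiseWQ cF L κ₀ η f x₀ s hmax R Hs B k
        ≤ max (max (betaPotentialWQ cF L κ₀ η f x₀ s hmax R Hs B (k + 1) - betaPotentialWQ cF L κ₀ η f x₀ s hmax R Hs B k) 0)
            (retouchRiseWQ cF L κ₀ η f x₀ s hmax R Hs B k) := le_max_right _ _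
    have hd0 : 0 ≤ 4 * max (-dropQ η f x₀ s hmax R Hs B k) 0 / s := by positivity
    by_cases hj : Charged (PTrkSQ PBot) StTrkDQ ReadyR2 η f x₀ s hmax R Hs B k ∧ BetaLevelQ κ₀ η f x₀ s hmax R Hs B k
    · rw [if_pos hj]
      obtain ⟨hch, hβ⟩ := hj
      have hfb : firstBetaQ κ₀ η f x₀ s hmax R Hs B ≤ k := firstBetaQ_le hβ
      obtain ⟨happ, v, z, hlow, ht, ha, hfl⟩ := hβ
      have hex : ∃ p : ℂ × ℂ, BetaWitnessQ κ₀ η f x₀ s hmax R Hs B k p := ⟨(v, z), hch, happ, hlow, ht, ha, hfl⟩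
      obtain ⟨hch', happ', hlow', ht', ha', hfl'⟩ := Classical.choose_spec hex
      have hRTB : retouchRiseWQ cF L κ₀ η f x₀ s hmax R Hs B k
          = max (phiLE (cF η f x₀ s hmax R Hs B) L η s Hs (touchEnergyQ η f x₀ s hmax R Hs B (k + 1))
              - phiLE (cF η f x₀ s hmax R Hs B) L η s Hs
                  (childEnergy f k (pairUnion (Classical.choose hex).1 (Classical.choose hex).2))) 0 := by
        unfold retouchRiseWQ; rw [dif_pos hex]
      have hΦk := betaPotentialWQ_of_le (cF := cF) (L := L) hfb
      have hΦk1 := betaPotentialWQ_of_le (cF := cF) (L := L) (hfb.trans (Nat.le_succ k))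
      -- the chosen pair's energies
      have hrow := hT η f x₀ s hmax R Hs B hE k _ _ hch' happ' hlow' ht' ha' hfl'
      have hΔ0 := drop_nonneg_of_lawWQ hT hE hc hch' happ' hlow' ht' ha' hfl'
      obtain ⟨he2, hHs⟩ := pair_le_twoHsSq hE hlow' ht'
      have hcE0 : 0 ≤ childEnergy f k (pairUnion (Classical.choose hex).1 (Classical.choose hex).2) := childEnergy_nonneg _ _ _
      have hcEe : childEnergy f k (pairUnion (Classical.choose hex).1 (Classical.choose hex).2)
          ≤ (Classical.choose hex).1.im ^ 2 + (Classical.choose hex).2.im ^ 2 := by linarith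
      have heE := pair_le_touchEnergyQ hE hlow' ht'
      have hEk2 := touchEnergyQ_le hE k
      -- (1) the potential pays at least one unit between the pair energy and the children's energy
      have htan := phiLE_sub_ge (η := η) (s := s) hc hL hHs hcE0 hcEe he2
      have hunit : 1 ≤ η ^ 2 / (cF η f x₀ s hmax R Hs B * s ^ 2)
          * (logWeight L Hs ((Classical.choose hex).1.im ^ 2 + (Classical.choose hex).2.im ^ 2) ^ 2
            * (((Classical.choose hex).1.im ^ 2 + (Classical.choose hex).2.im ^ 2)
              - childEnergy f k (pairUnion (Classical.choose hex).1 (Classical.choose hex).2))) := by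
        rw [div_mul_eq_mul_div, le_div_iff₀ (by positivity), one_mul]
        linarith
      have hpay := hunit.trans htan
      -- (2) monotonicity from the pair energy up to the meter
      have hmono := phiLE_mono (η := η) (s := s) hc hL hHs (by positivity) heE hEk2
      -- (3) the retouch rise covers the rest
      have hR : phiLE (cF η f x₀ s hmax R Hs B) L η s Hs (touchEnergyQ η f x₀ s hmax R Hs B (k + 1))
          - phiLE (cF η f x₀ s hmax R Hs B) L η s Hs (childEnergy f k (pairUnion (Classical.choose hex).1 (Classical.choose hex).2))
          ≤ retouchRiseWQ cF L κ₀ η f x₀ s hmax R Hs B k := by rw [hRTB]; exact le_max_left _ _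
      show betaPotentialWQ cF L κ₀ η f x₀ s hmax R Hs B (k + 1) + (1 - 4 * dropQ η f x₀ s hmax R Hs B k / s)
        ≤ betaPotentialWQ cF L κ₀ η f x₀ s hmax R Hs B k
          + (max (max (betaPotentialWQ cF L κ₀ η f x₀ s hmax R Hs B (k + 1) - betaPotentialWQ cF L κ₀ η f x₀ s hmax R Hs B k) 0)
              (retouchRiseWQ cF L κ₀ η f x₀ s hmax R Hs B k)
            + 4 * max (-dropQ η f x₀ s hmax R Hs B k) 0 / s)
      rw [hΦk, hΦk1] at hm1 hR' ⊢
      linarith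
    · rw [if_neg hj, add_zero]
      show betaPotentialWQ cF L κ₀ η f x₀ s hmax R Hs B (k + 1)
        ≤ betaPotentialWQ cF L κ₀ η f x₀ s hmax R Hs B k
          + (max (max (betaPotentialWQ cF L κ₀ η f x₀ s hmax R Hs B (k + 1) - betaPotentialWQ cF L κ₀ η f x₀ s hmax R Hs B k) 0)
              (retouchRiseWQ cF L κ₀ η f x₀ s hmax R Hs B k)
            + 4 * max (-dropQ η f x₀ s hmax R Hs B k) 0 / s)
      linarith

/-! ## §G5 ★★ Composition to ★A's literal type -/

/-- (K) class laws are MONOTONE in the allowance (on legal frames). -/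
theorem classLawQ_mono {𝓚 : LevelClass} {a a' : Budget} (h : ClassLawQ 𝓚 a)
    (hle : ∀ (η : ℝ) (f : ℂ → ℂ) (x₀ s hmax R Hs : ℝ) (B : ℕ), EngineHyps5 2 η f x₀ s hmax R Hs B →
      a η f x₀ s hmax R Hs B ≤ a' η f x₀ s hmax R Hs B) : ClassLawQ 𝓚 a' :=
  fun η f x₀ s hmax R Hs B hE k hk => (h η f x₀ s hmax R Hs B hE k hk).trans (hle η f x₀ s hmax R Hs B hE)

/-- (K) ★A's class reassembled: a β class law and a law for the REST of the approach class give `ApproachAllowanceQ (aβ + aRest)`. -/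
theorem approachAllowanceQ_of_beta_rest {κ₀ : ℝ} {aβ aRest : Budget} (hβ : ClassLawQ (BetaLevelQ κ₀) aβ)
    (hrest : ClassLawQ (diffClass ApproachLevelQ (BetaLevelQ κ₀)) aRest) : ApproachAllowanceQ (addBudget aβ aRest) := by
  have hU := classLawQ_union hβ hrest
  exact classLawQ_congr (fun η f x₀ s hmax R Hs B j => ⟨fun h => h.elim (fun hb => hb.1) id, fun h => Or.inr h⟩) hU

/-- ★★ (K, modulo the NAMED hypotheses) **THE GLUE v5**: W(cF) with `cF > 0` on legal frames + (Γ3′) RISE ALLOWANCE + (Γ4) the rest of the approach class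
+ FIT_W ⟹ `ApproachAllowanceQ (approachBudgetHalfQ aR aC)` for ANY budgets `aR aC` the fit is stated against. -/
theorem approachC_of_TW {cF : Budget} {L κ₀ : ℝ} {aT aRest aR aC : Budget}
    (hcF : ∀ (η : ℝ) (f : ℂ → ℂ) (x₀ s hmax R Hs : ℝ) (B : ℕ), EngineHyps5 2 η f x₀ s hmax R Hs B → 0 < cF η f x₀ s hmax R Hs B)
    (hL : 0 ≤ L) (hT : TouchedDissipationLawWQ cF L κ₀) (hrise : TouchRiseLawWQ cF L κ₀ aT)
    (hrest : ClassLawQ (diffClass ApproachLevelQ (BetaLevelQ κ₀)) aRest)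
    (hfit : ∀ (η : ℝ) (f : ℂ → ℂ) (x₀ s hmax R Hs : ℝ) (B : ℕ), EngineHyps5 2 η f x₀ s hmax R Hs B →
      betaPurseWQ cF L η f x₀ s hmax R Hs B + aT η f x₀ s hmax R Hs B + aRest η f x₀ s hmax R Hs B
        ≤ approachBudgetHalfQ aR aC η f x₀ s hmax R Hs B) :
    ApproachAllowanceQ (approachBudgetHalfQ aR aC) :=
  classLawQ_mono (approachAllowanceQ_of_beta_rest (betaClassLaw_of_TW hcF hL hT hrise) hrest)
    (fun η f x₀ s hmax R Hs B hE => by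
      show betaPurseWQ cF L η f x₀ s hmax R Hs B + aT η f x₀ s hmax R Hs B + aRest η f x₀ s hmax R Hs B ≤ _
      exact hfit η f x₀ s hmax R Hs B hE)

/-- ★★ (K) the CANONICAL instance — literally the registry's `stub_approachC` conclusion `ApproachAllowanceQ (approachBudgetHalfQ riseSupQ consSupQ)`. -/
theorem approachC_of_TW_canonical {cF : Budget} {L κ₀ : ℝ} {aT aRest : Budget}
    (hcF : ∀ (η : ℝ) (f : ℂ → ℂ) (x₀ s hmax R Hs : ℝ) (B : ℕ), EngineHyps5 2 η f x₀ s hmax R Hs B → 0 < cF η f x₀ s hmax R Hs B)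
    (hL : 0 ≤ L) (hT : TouchedDissipationLawWQ cF L κ₀) (hrise : TouchRiseLawWQ cF L κ₀ aT)
    (hrest : ClassLawQ (diffClass ApproachLevelQ (BetaLevelQ κ₀)) aRest)
    (hfit : ∀ (η : ℝ) (f : ℂ → ℂ) (x₀ s hmax R Hs : ℝ) (B : ℕ), EngineHyps5 2 η f x₀ s hmax R Hs B →
      betaPurseWQ cF L η f x₀ s hmax R Hs B + aT η f x₀ s hmax R Hs B + aRest η f x₀ s hmax R Hs B
        ≤ approachBudgetHalfQ riseSupQ consSupQ η f x₀ s hmax R Hs B) :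
    ApproachAllowanceQ (approachBudgetHalfQ riseSupQ consSupQ) :=
  approachC_of_TW hcF hL hT hrise hrest hfit

/-- ★★ (K) **T⁗ INSTANCE WITH THE TWO-BRACKET FIT_W**: since `w_F ≤ 1 + θ·(B+1)·(s/Hs)²`, the weighted purse is at most `φ₀·(Hs/s)² + φ₀·θ·(B+1)`
(`φ₀ = (1+2L+2L²)/(2c)`: the P-bracket and the B-bracket of the benches), so T⁗(c, L, κ₀, θ) + Γ3′ + Γ4 + that fit give ★A at the canonical budgets. -/
theorem approachC_of_TQ_brackets {c L κ₀ θ : ℝ} {aT aRest : Budget} (hc : 0 < c) (hL : 0 ≤ L) (hθ : 0 ≤ θ)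
    (hT : TouchedDissipationLawTQ c L κ₀ θ) (hrise : TouchRiseLawWQ (weightedConstQ c θ) L κ₀ aT)
    (hrest : ClassLawQ (diffClass ApproachLevelQ (BetaLevelQ κ₀)) aRest)
    (hfit : ∀ (η : ℝ) (f : ℂ → ℂ) (x₀ s hmax R Hs : ℝ) (B : ℕ), EngineHyps5 2 η f x₀ s hmax R Hs B →
      (1 + 2 * L + 2 * L ^ 2) / (2 * c) * (Hs / s) ^ 2 + (1 + 2 * L + 2 * L ^ 2) / (2 * c) * θ * ((B : ℝ) + 1)
        + aT η f x₀ s hmax R Hs B + aRest η f x₀ s hmax R Hs B ≤ approachBudgetHalfQ riseSupQ consSupQ η f x₀ s hmax R Hs B) :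
    ApproachAllowanceQ (approachBudgetHalfQ riseSupQ consSupQ) := by
  refine approachC_of_TW (fun η f x₀ s hmax R Hs B _ => weightedConstQ_pos hc θ η f x₀ s hmax R Hs B) hL hT hrise hrest
    (fun η f x₀ s hmax R Hs B hE => ?_)
  have hs : 0 < s := hE.2.2.2.1
  have hq : 0 ≤ 1 + 2 * L + 2 * L ^ 2 := by nlinarith
  have hw := frameWeightQ_le hθ η f x₀ s hmax R Hs B
  have hw0 := frameWeightQ_pos θ η f x₀ s hmax R Hs B
  -- `(Hs/s)²·(s/Hs)² ≤ 1` (`= 1` unless `Hs = 0`, when it is `0`)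
  have hprod : (Hs / s) ^ 2 * (s / Hs) ^ 2 ≤ 1 := by
    by_cases hHs : Hs = 0
    · rw [hHs]; simp
    · rw [← mul_pow, div_mul_div_comm, mul_comm Hs s, div_self (mul_ne_zero hs.ne' hHs)]; norm_num
  have hp : betaPurseWQ (weightedConstQ c θ) L η f x₀ s hmax R Hs B
      = (1 + 2 * L + 2 * L ^ 2) / (2 * c) * (Hs / s) ^ 2 * frameWeightQ θ η f x₀ s hmax R Hs B := by
    rw [betaPurseWQ_apply]; unfold weightedConstQ; field_simp
  have hb : betaPurseWQ (weightedConstQ c θ) L η f x₀ s hmax R Hs B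
      ≤ (1 + 2 * L + 2 * L ^ 2) / (2 * c) * (Hs / s) ^ 2 + (1 + 2 * L + 2 * L ^ 2) / (2 * c) * θ * ((B : ℝ) + 1) := by
    rw [hp]
    have hφ0 : 0 ≤ (1 + 2 * L + 2 * L ^ 2) / (2 * c) * (Hs / s) ^ 2 := by positivity
    calc (1 + 2 * L + 2 * L ^ 2) / (2 * c) * (Hs / s) ^ 2 * frameWeightQ θ η f x₀ s hmax R Hs B
        ≤ (1 + 2 * L + 2 * L ^ 2) / (2 * c) * (Hs / s) ^ 2 * (1 + θ * ((B : ℝ) + 1) * (s / Hs) ^ 2) :=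
          mul_le_mul_of_nonneg_left hw hφ0
      _ = (1 + 2 * L + 2 * L ^ 2) / (2 * c) * (Hs / s) ^ 2
          + (1 + 2 * L + 2 * L ^ 2) / (2 * c) * θ * ((B : ℝ) + 1) * ((Hs / s) ^ 2 * (s / Hs) ^ 2) := by ring
      _ ≤ (1 + 2 * L + 2 * L ^ 2) / (2 * c) * (Hs / s) ^ 2 + (1 + 2 * L + 2 * L ^ 2) / (2 * c) * θ * ((B : ℝ) + 1) * 1 := by
          have hk : 0 ≤ (1 + 2 * L + 2 * L ^ 2) / (2 * c) * θ * ((B : ℝ) + 1) := by positivity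
          linarith [mul_le_mul_of_nonneg_left hprod hk]
      _ = _ := by ring
  linarith [hfit η f x₀ s hmax R Hs B hE]

end RhW08.TouchedGlueW
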